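import Mathlib
import HarnessLib
import HarnessLib.Audit
import Summits.ResolutionOfSingularities.Statement
import HarnessLib.Audit.Status.Attr

/-!
Route: EscapeRate

# Route EscapeRate — ISOLATED persistence is exponentially rare over finite fields; rarity plus
determinacy terminates the isolated core, then steer

Operator computational-witness. It suffices to show X = L ∧ R ∧ S ∧ T ∧ P ∧ D. L =
LinearCodimGrowthIso (rank 2, THE CERTIFICATE; repaired
2026-08-17 — the unrestricted LinearCodimGrowth was refuted-misstated and stays in the file as a
settled negative edge): for every prime p and
n ≥ 1 there are a rational slope a/b > 0 and a constant C such that, for every depth N, every window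
M ≥ p(N+2) and every sufficiently large
finite field κ of characteristic p, the number of height-one atoms z^p = a(u_1..u_n) with
coefficients in κ supported in degrees ≤ M that admit
a word (charts and translation points, translations allowed in κ̄ — exactly the typed coefficient
calculus of stmt-16343) along which ALL states
0..N of the point-blow-up dynamics are ISOLATED (the target's `Isol`: finite Jacobian colength of
the cleaned series) AND of multiplicity p is
at most q^(D_M + C − (a/b)·N), q = |κ|, D_M = C(M+n, n): the ISOLATED persistence locus P_N^iso has
codimension growing LINEARLY in N
("long isolated persistence is exponentially rare"; card persistence-exponent-escape-rate-v2,
counted over F_q as its μ_q). Unrestricted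
persistence is NOT rare: a start of cleaned order ≥ 2p becomes u_i^p·b after one blow-up, the
exceptional hyperplane is a p-fold locus of the
state and persists for free (codimension ≤ 17 at (p,n) = (2,2) for every N:
Theorems/LinearCodimGrowth/Negative/EternalFamily.lean,
EscapeRateLinearCodimGrowth_refuted) — exactly the non-isolated (unforced) regime the route always
delegated to Steer; the certificate now
counts what the target forbids. R = RarityToTerminationIso (rank 4): L ⇒ IsolatedForcedTermination
(the shared target stmt-16343: no
infinite all-isolated multiplicity-p run over any perfect field), by finite determinacy (an isolated
bad atom drags a whole CYLINDER of
starts — all right-equivalent to it, hence all-ISOLATED persistent — into every P_N^iso, of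
codimension independent of N) + completeness of
ACF_p + counting. S, T, P, D = Steer, TorsorToLurelPerfect, PatchingRelPerfect, DescentPerfectToAll
(stmt-16345 / 16162 / 16161 / 0549,
shared verbatim with FrobeniusClosing / JacobianBudget / WildCones / ShadowGame). Structural inputs:
for a fixed word the persistence
conditions are κ̄-LINEAR in the class [a] (Giraud1975 / CossartPiltant2019 §2.4), so each stratum of
P_N^iso is an algebraic family of linear
kernels over the word variety and its point count is a rank computation; isolatedness confines every
non-final state of a counted run to
cleaned order p or p+1 (n = 2) and exactly p (n ≥ 3), because cleaned order ≥ p+2 before a blow-up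
puts the Jacobian ideal of the next state
inside (u_i) (refuter notes on stmt-16343 / 18129) — the Moh window in which the condition count is
read.
Lean: `LinearCodimGrowthIso ∧ RarityToTerminationIso ∧ Steer ∧ TorsorToLurelPerfect ∧
PatchingRelPerfect ∧ DescentPerfectToAll`

## Assembly
Pure logic (glue.lean, rev 9: gate-certified native, 0 sorries; `closes` takes the Assembly item and
every crux as hypotheses):
RarityToTerminationIso applied to LinearCodimGrowthIso gives the target IsolatedForcedTermination;
Steer turns it into TorsorLUPerfect's
body; at a prime p, TorsorToLurelPerfect gives relative LU over perfect k, PatchingRelPerfect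
resolution over perfect k, DescentPerfectToAll
ResolutionInChar p; the summit is ∀ p, p.Prime → ResolutionInChar p by definition:
`closes (hA : Assembly) hL hR hS hT hP hD := hA hL hR hS hT hP hD`, and the Assembly item itself
(rank 1, pure logic, claimable by anyone) is
proved by `fun hL hR hS hT hP hD p hp => hD p hp (hP p hp (hT p hp (hS (hR hL) p hp)))`.

Rationale: WHY THIS LINE. MECHANISM = an ESCAPE RATE instead of an invariant (transplant from open dynamical
systems: Pianigiani–Yorke 1979, Demers–Young
doi:10.1088/0951-7715/19/2/008, dictionary in card persistence-exponent-escape-rate-v2: phase space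
↦ the space of all atoms, map ↦
blow-up-and-localise, hole ↦ multiplicity drop OR loss of isolatedness, survivor set ↦ the isolated
persistence locus P_N^iso, escape rate ↦
lim κ(N)/N): nothing is asked to drop along any run — kangaroo steps (Moh1987, Hauser2008Kangaroo)
and Hauser–Perlega's unbounded residual
orders (arXiv:1802.05010) are allowed to exist as measure-zero strata; what is claimed is that each
blow-up step imposes, amortised along every
word, strictly more independent linear conditions on [a] (C(n+p−1,n)−1 fresh order-< p coefficients)
than the n−1 moduli of the translation
point, so codimension — which is ADDITIVE along runs where a pointwise invariant is not — grows
linearly; finite determinacy of isolated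
singularities in characteristic p (BoubakriGreuelMarkwig2010 = arXiv:1005.4503, arXiv:1708.02442)
converts "rare" into "impossible" for the
isolated (forced) core, because one bad isolated atom would put a positive-density cylinder inside
every P_N^iso over arbitrarily large finite
fields (Lang–Weil-free counting, LangWeil1954 only as heuristic). REPAIR 2026-08-17: the first
certificate counted persistence of ANY kind and
was refuted-misstated (Theorems/EscapeRateLinearCodimGrowthRefutation.lean: cleaned order ≥ 2p
persists for free at bounded codimension,
the exceptional hyperplane being a p-fold locus); the certificate now counts exactly the
all-ISOLATED runs the target forbids (refuter's C′,
recommended independently by the crux-attack on stmt-18129), and isolatedness pins every non-final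
state to the order window {p, p+1} (n = 2)
/ {p} (n ≥ 3). Imported areas: escape rates / conditionally invariant measures (dynamics), incidence
counting of conditions imposed by
infinitely near points (Casas-Alvero 2000 Prop 4.7.1, Hoskin–Deligne), finite determinacy
(singularity theory), point counting over finite
fields. No listed route bounds a DENSITY: FrobeniusClosing excludes PERIODIC orbits over finite
fields and needs BoundedMilnor;
JacobianBudget/WildCones/ShadowGame want a quantity that drops or a strategy that wins pointwise;
here increases are free and only the
amortised condition count matters, and the certificate per (p, n) is an exact symbolic rank-growth
computation (kernel tree over
F_p(τ_1..τ_N); card jobs x4/x5 and exp/linker2.py: minimum balance +1 per step at q = 2, ≥ 2 at q =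
3, 4, n ≤ 4, depth ≤ 5 — generic and
F_q-special strata, which for isolated runs are the relevant ones; the τ = 0 high-order stratum they
missed is the non-isolated one now excluded).

RANKED CRUXES. #0 IsolatedForcedTermination (target) — the TARGET (shared verbatim, stmt-16343): no
start series, chart sequence and translation sequence over a perfect field of char p yields an
INFINITE run of the point-blow-up dynamics of a height-one atom all of whose states are isolated of
multiplicity p. Derived in `closes` as RarityToTerminationIso LinearCodimGrowthIso; consumed by
Steer. (why it might fail: a forced Hauser–Perlega cycle or a pumping eternal isolated chain refutes
it; LinearCodimGrowthIso says isolated persistence is too rare for an isolated germ's determinacy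
cylinder.) [arXiv:1802.05010, arXiv:1412.0868, arXiv:1005.4503]
#2 LinearCodimGrowthIso (crux) — THE CERTIFICATE, repaired (card persistence-exponent-escape-rate-v2
K1, finite-field form, isolated persistence). For every prime p and n ≥ 1 there are a b C : ℕ, a, b
> 0, such that for all N, M with p(N+2) ≤ M and all sufficiently large finite fields κ of char p:
every finite family F of starts c₀ : (Fin n → ℕ) → κ supported in degrees ≤ M, each admitting a word
(charts i, translations t in the algebraic closure of κ) along which ALL states 0..N of the
point-blow-up dynamics (verbatim from stmt-16343) are isolated (`Isol`, verbatim from the target)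
and of multiplicity p (`MultP`), satisfies |F|^b · q^(aN) ≤ q^(b(C + C(M+n,n))). COMPUTE-SEAT JOB
SPEC: for (p,n) ∈ {2,3}×{2,3,4} enumerate the strata of isolated order-p states (n = 2: order ≤ p+1)
and their isolated multiplicity-p successors over ALL charts and translation points — generic τ as
indeterminates AND the τ = 0 / F_q-special strata credited with their dimension — to depth N ≤ 8 by
exact linear algebra over F_p(τ); report the minimum over strata of (rank of the stacked conditions
− stratum dimension) per step; a positive-dimensional stratum of slope ≤ 0 sustained to the depth
bound is the kill. [difficulty: open-problem] (why it might fail: at p = 2 the margin is ONE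
condition per step (net +1 generically at order-2 states); a positive-dimensional stratum of
isolated order-p states whose successor condition recurs automatically — a cheap eternal ISOLATED
family — gives slope ≤ 0.) [arXiv:1802.05010, Moh1987, Hauser2008Kangaroo, arXiv:1412.0868,
Giraud1975, arXiv:1005.4503, doi:10.1088/0951-7715/19/2/008,
Summit.ResolutionOfSingularities.ResolutionOfSingularities.Theorems.EscapeRateLinearCodimGrowth_refuted]
(#2 of rev 0–7, LinearCodimGrowth — persistence of ANY kind — is REFUTED, class misstated, by
EscapeRateLinearCodimGrowth_refuted @ fb13758004db and stays in the file as the settled negative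
edge; never re-wanted.)
#3 Steer (crux) — STEERING (shared verbatim, stmt-16345): IsolatedForcedTermination ⇒ α_p-torsors
over bases regular at the centre are uniformizable along every valuation over every perfect field
(the body of TorsorLUPerfect inlined): at unforced stages choose a positive-dimensional permissible
coordinate-stratum centre and return to the isolated regime or drop multiplicity. [deps:
RarityToTerminationIso] [difficulty: open-problem] (why it might fail: the unforced regime may carry
the whole difficulty (CossartPiltant2019 Rem 3.2: ω rises under a permissible centre in dim 4;
Hauser–Perlega cycles are unforced, and the refuting eternal family of rev 7 is unforced too): then
forced termination buys nothing and Steer is LuAlphaPTorsor again.) [arXiv:1412.0868,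
arXiv:1802.05010, CutkoskyMourtada2019, NovacoskiSpivakovsky2014, Temkin2013,
Literature.Barriers.ResolutionOfSingularities.DimensionFourFrontier]
#4 RarityToTerminationIso (crux) — RARITY + DETERMINACY ⇒ TERMINATION OF THE ISOLATED CORE:
LinearCodimGrowthIso → IsolatedForcedTermination (supersedes RarityToTermination, vacuous once its
antecedent was refuted). Plan: (i) an infinite all-isolated multiplicity-p run from a₀ over a
perfect κ gives, by RIGHT finite determinacy of the isolated cleaned series (BGM Cor 2.4, bound 2μ −
ord + 2; Literature.AlgebraicGeometry.Resolution.BoubakriGreuelMarkwig.Cor24, vendored) and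
transport of runs along κ̄[[u]]-automorphisms (blow-up of the closed point, exceptional divisor and
division by its equation are intrinsic; every closed point of E is a chart point; Isol and MultP are
invariant), that every a ≡ a₀ mod m^(M′) over κ̄ has an N-step all-isolated multiplicity-p word for
every N — the cylinder lies in P_N^iso, which is what the certificate counts; (ii) "some M′-jet
whose whole degree-≤-M fibre persists N steps isolatedly" is a first-order sentence over F_p (Isol
on the fibre ⟸ colength ≤ B, B uniform on the cylinder by transport), true in κ̄, hence in F̄_p
(Mathlib FirstOrder.Field.ACF_isComplete), giving a cylinder of codimension D_(M′) inside
P^iso_(N,M) over F_(Q^s) for all s; (iii) counting: |cylinder| = q^(D_M − D_(M′)) contradicts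
|P^iso| ≤ q^(D_M + C − (a/b)N) once (a/b)N > C + D_(M′). [deps: LinearCodimGrowthIso] [difficulty:
XL] (why it might fail: transport of the typed `step` along K[[u]]-automorphisms is unpublished; the
ACF_p sentence must encode `run` and a uniform colength bound as an L_ring formula — laborious; BGM
Cor 2.4 is a vendored unproved leaf.) [arXiv:1005.4503, arXiv:1708.02442, arXiv:1802.05010,
Literature.AlgebraicGeometry.Resolution.BoubakriGreuelMarkwig.Cor24, Varshavsky2014, LangWeil1954]
#5 TorsorToLurelPerfect (crux) — Temkin's inseparable reduction over PERFECT ground fields (shared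
verbatim, stmt-16162): LU of α_p-torsors over bases regular at the centre ⇒ relative LU for every
f.g. K/k, k perfect of char p (Temkin2013 Thm 1.3.2 + Frobenius transport + the degree-p radical
tower). [deps: Steer] [difficulty: L] (why it might fail: rests on Temkin2013 Thm 1.3.2 (vendored
fact with an unproved leaf Temkin2013RelativeCurveSmoothFibre) and on Temkin's model dominating the
GIVEN R (relative form); smooth ≠ regular bookkeeping at each tower step.) [Temkin2013,
arXiv:0804.1554, Literature.AlgebraicGeometry.Resolution.Temkin2013Relative,
Literature.Barriers.ResolutionOfSingularities.InseparableBaseChange]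
#6 PatchingRelPerfect (crux) — Zariski patching over PERFECT ground fields (shared verbatim,
stmt-16161): relative local uniformization for all f.g. K/k, k perfect of char p ⇒ every reduced
separated scheme of finite type over every perfect field of char p has a resolution. [deps:
TorsorToLurelPerfect] [difficulty: open-problem] (why it might fail: patching LUs into one proper
regular model is known only in dim ≤ 3 (Zariski; CossartPiltant2008 Prop 4.9 / Piltant2013 need
embedded resolution one dimension down); in dim ≥ 4 no reduction Res ⇐ LU exists even in char 0
(CutkoskyMourtada2019 p.3).) [CutkoskyMourtada2019, Temkin2013, CossartPiltant2019,
NovacoskiSpivakovsky2014, Literature.Barriers.ResolutionOfSingularities.DimensionFourFrontier]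
#7 DescentPerfectToAll (crux) — perfect fields ⇒ all fields (shared verbatim, stmt-0549): for a
prime p, resolution of all reduced separated finite-type schemes over all PERFECT fields of char p
implies ResolutionInChar p. [deps: PatchingRelPerfect] [difficulty: open-problem] (why it might
fail: only known mechanism spreads X over a f.g. field of definition and base-changes a resolution
over a perfect subfield back; regular is not geometrically regular under inseparable extension (EGA
IV 6.7.4), e.g. k = F_p((t)) (Temkin2008 Question 3.3.3 open).) [arXiv:math/0703678, Kollar2007,
Literature.Barriers.ResolutionOfSingularities.InseparableBaseChange,
Literature.Barriers.ResolutionOfSingularities.RegularNotGeometricallyRegular]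

TWO-LAYER PLAN. Foreseen glued splits, filed only after a census: LinearCodimGrowthIso ⇐ OrderWindow
(Isol ∧ MultP at consecutive states ⇒ cleaned order
of the earlier state ∈ {p, p+1}, = p for n ≥ 3 — the Jacobian-in-(u_i) argument; M-sized, provable
now, the natural first `--supports` lemma) →
LCGIso_two (p = 2, margin-one regime: the dependency RATE along every stratum of isolated order-2
states stays < 1 — successors only at
ridge-vertex points of the cleaned quadratic form, one cubic condition per step) → LCGIso_odd (odd
p, margin C(n+p−1,n) − n per step: a crude rank
bound on the one-step condition matrix should suffice) → LinearCodimGrowthIso;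
RarityToTerminationIso ⇐ CylinderIso (¬target ⇒ an all-isolated
cylinder family over finite fields: right determinacy + transport + ACF_p) → NoCylinderIso (LCGIso ⇒
no such family: arithmetic) →
RarityToTerminationIso; Steer as in FrobeniusClosing (UnforcedReturn → Dictionary).

KILL CRITERIA. (i) A positive-dimensional stratum of all-ISOLATED persistent runs whose amortised
balance (conditions − moduli) is ≤ 0 to unbounded
depth — found by the rank-2 kit computation or by hand (a "cheap eternal isolated family"; for n ≥ 3
necessarily a chain of order-p states) —
refutes LinearCodimGrowthIso: close `refuted:LinearCodimGrowthIso` unless the refuter classes it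
misstated with a repair that still feeds
RarityToTerminationIso (the non-isolated version of this kill HAPPENED at rev 7 and is why rank 2
now counts isolated persistence only; a second
misstatement of the same certificate means the line is not typable and the route closes
`exhausted`). (ii) A forced isolated cycle
(FrobeniusClosing's kill) refutes IsolatedForcedTermination and hence LinearCodimGrowthIso ∧
RarityToTerminationIso: close with
FrobeniusClosing/JacobianBudget/WildCones at that node. (iii) ¬PatchingRelPerfect or
¬DescentPerfectToAll proved ⇒ the whole LU family dies there;
close `superseded`/`refuted` with them. (iv) IsolatedForcedTermination proved by another engine
(Jacobian budget, cone exit, closing) moots ranks 2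
and 4 (close `superseded --by` that route); LuAlphaPTorsor (stmt-0641) proved moots ranks 2–4.

NOT DECOMPOSED YET. The localisation / variational principle (card K2: lim κ(N)/N as a minimum over
renormalisation-stable degenerate configurations) —
a layer-2 child of LinearCodimGrowthIso only if the direct rank-growth bound fails; the climb from
isolated germs to schemes without the LU chain
(card K3, route IsolatedCore's business); the dimension-theoretic form of the certificate (dim
P_N^iso ≤ D_M + C − (a/b)N over F̄_p, equivalent by
Lang–Weil, not typable cheaply); imperfect residue fields (routed through DescentPerfectToAll, as
every route of the family); weighted or
positive-dimensional centres and the non-isolated persistence strata (outside the forced format by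
design — Steer's business, and the content
of the rev-7 refutation).

CHEAPEST FALSIFIER. (p, n) = (2, 3) first (order window {2}: successors of an isolated order-2 state
sit only at ridge-vertex points of the cleaned
quadratic form), then (2, 2) (window {2, 3}) and (2, 4): enumerate isolated order-p states over F_2
/ F_4 supported in degree ≤ M = 2(N+2) and
their isolated multiplicity-2 successors over ALL charts and translation points INCLUDING τ = 0 and
the F_q-special strata (the stratum the
card's x4/x5 protocol missed), to depth N = 6 (≈ hours on kit): a positive-dimensional stratum with
balance ≤ 0 per step sustained to the depth
bound kills LinearCodimGrowthIso in its home case. By hand: n = 1 (Isol is automatic for a non-zero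
cleaned series; the dynamics is a pure
exponent shift; P_N^iso = {ord(clean a) ≥ p(N+1)}, codimension exactly (p−1)(N+1): linear, slope p −
1, so the statement is neither vacuous
nor superlinear in its first instance); the Lean vacuity pass (C is chosen before N; the trivial
bound |F| ≤ q^(D_M) forces nothing; the
refuting family (cleaned order ≥ 2p) and the eternal fixed point u_1·u_2^p fail Isol at state 1
resp. 0 — Jacobian ideal inside (u_1) resp.
(u_2^p) — so neither transfers to the repaired certificate; Sketch.lean rc 0).

NUMBERS. Naive per-step condition count C(n+p−1, n) − 1 against n − 1 moduli: p = 2: n vs n − 1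
(margin 1); p = 3, n = 4: 14 vs 3; p = 5,
n = 4: 69 vs 3. Moh's bound at height one: residual order rises by at most p^0 = 1 per kangaroo
(Moh1987). Order window of an all-isolated run
(n ≥ 2): cleaned order ∈ {p, p+1} before every blow-up, = p for n ≥ 3. Refuted unrestricted
certificate: eternal non-isolated family of
codimension ≤ 17 at (p, n) = (2, 2), every N, M ≥ 5 (EternalFamily.lean). Card data (jobs x4/x5,
2026-08-15/16): balance ≥ +1 per step, q = 2,
n ≤ 4, depth ≤ 5. Determinacy bound for isolated hypersurface singularities in char p: 2μ − ord + 2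
(arXiv:1005.4503 Cor 2.4). Items after the
repair: 8 active (6 cruxes, 1 target, 1 assembly) + 2 inactive records (LinearCodimGrowth refuted,
RarityToTermination replaced).

DEFINITION REQUESTS. None: the dynamics is the `let`-bound generator of stmt-16343 verbatim (so the
target and the chain dedup to the existing
items), instantiated over `AlgebraicClosure κ` for the words, and `Isol` is literally
`Literature.AlgebraicGeometry.Resolution.BoubakriGreuelMarkwig.IsIsolated`
of the cleaned series up to unfolding; if provers want it factored, the definition item
`TorsorShadowStep` foreseen by ShadowGame serves all
five engine routes at once.

Novelty: Searches (2026-08-17): all 36 open route files (headers; full items of FrobeniusClosing,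
JacobianBudget, ShadowGame, WildCones,
UniversalCells, RuledResidues, WildPurity); the Ideas index (79 open + 107 closed cards, titles +
grades; full reads of
persistence-exponent-escape-rate-v2, frobenius-linear-losing-set,
irregularity-budget-function-field, k-regularity-vorst-forwards,
wild-jets-are-rigid-lang-steinberg, narasimhan-is-reed-muller, henon-valuations-self-similar-shape,
finite-field-summit-equisingular-transfer,
mu-p-fixed-locus-universality, quiver-grassmannian-rigidification, renormalise-the-stall,
tau-sheaf-ore-euclid, frobenius-flat-directions,
separable-suspension-points, kunz-frobenius-flattening-tower (closed: falsified)); `ledger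
negatives` (1, DefectlessFrames, unrelated);
barrier catalogue (11 files); `lit frontier ResolutionOfSingularities --since 2024` (30 rows; read
arXiv:2605.22046 pp. 1–6 —
Merici–Rülling–Saito, A¹-invariant lattices, dim ≤ 3 in char p, unrelated to counting); `lit search
--source s2 "local uniformization
positive characteristic valuation 2025"` (15, 1 relevant: arXiv:2507.06743 Popescu,
Néron-desingularization side); `lit search --source
arxiv` ×2 (0 rows: service degraded), OpenAlex budget exhausted (stated as a limitation); `lean
search` of every constant in Sketch.lean.
Nearest prior art found: route-ResolutionOfSingularities-FrobeniusClosing (same arena and target;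
lever = periodicity over finite
fields via the Hrushovski–Varshavsky cl  [refs: 2605.22046, 2507.06743, 1005.4503]

Barriers (technique_class: escape-rate condition-counting determinacy): - technique_class: escape-rate condition-counting determinacy
- Literature.Barriers.ResolutionOfSingularities.Hauser2003_kangarooShadeIncrease: evaded — no
invariant is asked to drop; a kangaroo step is a step whose conditions are dependent, paid for
(amortised) by the steps that prepared it; it bites only if dependencies recur at rate 1 along a
positive-dimensional stratum (the p = 2 margin), which is exactly LinearCodimGrowth's kill
criterion.
- Literature.Barriers.ResolutionOfSingularities.hauserPerlega_mohProofBoundFails: consistent —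
Hauser–Perlega's runs are unforced (non-isolated) and live on measure-zero strata; the line allows
∩_N P_N ≠ ∅ and only forbids positive-density cylinders, which isolated bad germs would create.
- Literature.Barriers.ResolutionOfSingularities.Narasimhan1983_noSmoothHypersurfaceThroughTopLocus:
not engaged — no hypersurface of contact is chosen; conditions are read on all order-< p
coefficients at once.
- Literature.Barriers.ResolutionOfSingularities.DirectrixSmallCharacteristicNarrow: evaded by scope
— perfect (finite / algebraically closed) residue fields in the engine; imperfect fields only
through DescentPerfectToAll.
- Literature.Barriers.ResolutionOfSingularities.DimensionFourFrontier: it does not evade it; the bet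
is that the forced core is decided by counting (ranks 2, 4) and the frontier's missing ELU(4) is met
only inside Steer / PatchingRelPerfect, shared with four routes.
- Literature.Barriers.ResolutionOfSingularities.Inseparable

History (route lifecycle, newest last):
- 2026-08-17T14:15:54Z · BROKEN — LinearCodimGrowth (stmt-ResolutionOfSingularities-18128, crux) refuted by Summit.ResolutionOfSingularities.ResolutionOfSingularities.Theorems.EscapeRateLinearCodimGrowth_refuted @ fb13758004db (refuter-rattack-stmt-ResolutionOfSingularities-18128-0)
- 2026-08-17T14:40:16Z · rev 8: restated LinearCodimGrowth (stmt-ResolutionOfSingularities-18128 refuted), RarityToTermination (stmt-ResolutionOfSingularities-18129), Assembly (stmt-ResolutionOfSingularities-18130) — REPAIR (planner rbadge g5; route BROKEN since 14:15:54Z by EscapeRateLinearCodimGrowth_refuted, class misstated per the theorem  (planner-rbadge-ResolutionOfSingularities-Escap-008b830f-g5-0)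
- 2026-08-17T14:40:16Z · REPAIRED (restate LinearCodimGrowth, RarityToTermination, Assembly) — back to open: REPAIR (planner rbadge g5; route BROKEN since 14:15:54Z by EscapeRateLinearCodimGrowth_refuted, class misstated per the theorem docstring: non-isolated persiste (planner-rbadge-ResolutionOfSingularities-Escap-008b830f-g5-0)
- 2026-08-25T15:21:39Z · DORMANT — reconciler: no traction for 7.8 d (last activity item-evidence-added at 2026-08-17T19:18:24Z); parked, not closed — `ledger route dormant route-ResolutionOfSing (operator:999:87100)
- 2026-08-26T17:01:05Z · REACTIVATED — reconciler: reactivated — activity statement-claimed at 2026-08-26T16:25:04Z after parking at 2026-08-25T15:21:39Z (operator:999:3524840)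

sub-problem: ResolutionOfSingularities · status: open · opened planner-plan-novel-ResolutionOfSingularities-Re-dc19aa3a-d-v2-g29-0 2026-08-17T11:50:18Z · rev 11 · ledger route-ResolutionOfSingularities-EscapeRate
GENERATED by the gate from the ledger (D-0016/17). Provers cite these decls: `theorem foo : Summit.ResolutionOfSingularities.ResolutionOfSingularities.Theses.EscapeRate.<Decl> := …` in Summits/ResolutionOfSingularities/ResolutionOfSingularities/Theorems/<Name>.lean.
-/

namespace Summit.ResolutionOfSingularities.ResolutionOfSingularities.Theses.EscapeRate

open scoped BigOperators Topology Manifold Classical MeasureTheory ProbabilityTheory Matrix InnerProductSpace ComplexConjugate ContinuousMap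
open Filter Set Function TopologicalSpace MeasureTheory

attribute [summit_statement] _root_.ResolutionOfSingularities

/-- item stmt-ResolutionOfSingularities-16343 · target · rank 0 · closed · proved by Summit.ResolutionOfSingularities.ResolutionOfSingularities.Theorems.WildCones.IsolatedForcedTermination_proof (prover) · by planner
why it might fail: a forced Hauser–Perlega cycle or a pumping eternal isolated chain refutes it; LinearCodimGrowth says persistence of ANY kind is too rare for an isolated germ's determinacy cylinder.
sources: arXiv:1802.05010, arXiv:1412.0868, arXiv:1005.4503
[target] the TARGET (IsoDrop for height-one atoms, all n, all perfect fields): no start series,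
chart sequence and translation sequence over a perfect field of char p yields an INFINITE run of the
point-blow-up dynamics all of whose states are isolated of multiplicity p. Derived in `closes` as
ClosingReduction NoPeriodicIsolatedAtom BoundedMilnor; provable directly by anyone with a budget (a
ranking on μ-bounded states) — char 2 looks like a budget regime (spine card toy B: μ drops by a
constant at every forced step, ~290 steps, n = 3,4,5); consumed by Steer. -/
@[route_item "route-ResolutionOfSingularities-EscapeRate"]
def IsolatedForcedTermination : Prop :=
  ∀ p : ℕ, p.Prime → ∀ n : ℕ, 0 < n → ∀ (κ : Type) [Field κ] [CharP κ p] [PerfectField κ] (c₀ : (Fin n → ℕ) → κ) (i : ℕ → Fin n) (t : ℕ → Fin n → κ), let clean : ((Fin n → ℕ) → κ) → ((Fin n → ℕ) → κ) := fun c A => @ite κ (∀ j, p ∣ A j) (Classical.dec _) 0 (c A); let bl : Fin n → ((Fin n → ℕ) → κ) → ((Fin n → ℕ) → κ) := fun i c B => @ite κ (Finset.sum (Finset.univ.erase i) (fun j => B j) ≤ B i) (Classical.dec _) (c (Function.update B i (B i - Finset.sum (Finset.univ.erase i) (fun j => B j)))) 0; let ord : ((Fin n → ℕ) → κ) → ℕ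 := fun c => sInf {m : ℕ | ∃ A, c A ≠ 0 ∧ m = Finset.sum Finset.univ (fun j => A j)}; let dv : Fin n → ℕ → ((Fin n → ℕ) → κ) → ((Fin n → ℕ) → κ) := fun i s c B => c (Function.update B i (B i + s)); let tr : Fin n → (Fin n → κ) → ℕ → ((Fin n → ℕ) → κ) → ((Fin n → ℕ) → κ) := fun i τ s c B => Finset.sum (Fintype.piFinset (fun _ : Fin n => Finset.range (B i + s + 1))) (fun D => @ite κ (D i = 0) (Classical.dec _) (c (B + D) * Finset.prod (Finset.univ.erase i) (fun j => ((Nat.choose (B j + D j) (B j) : ℕ) : κ) * τ j ^ (D j))) 0); let step : Fin n → (Fin n → κ) → ((Fin n → ℕ) → κ) → ((Fin n → ℕ) → κ) := fun i τ c => clean (tr i τ (@ite ℕ (p ≤ ord (clean c)) (Classical.dec _) p 0) (dv i (@ite ℕ (p ≤ ord (clean c)) (Classical.dec _) p 0) (bl i (clean c)))); let run : ((Fin n → ℕ) → κ) → (ℕ → Fin n) → (ℕ → Fin n → κ) → ℕ → ((Fin n → ℕ) → κ) := fun c₀ i t m => @Nat.rec (fun _ => (Fin n → ℕ) → κ) c₀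 (fun m c => step (i m) (t m) c) m; let ser : ((Fin n → ℕ) → κ) → MvPowerSeries (Fin n) κ := fun c => show MvPowerSeries (Fin n) κ from fun A : Fin n →₀ ℕ => clean c ⇑A; let pd : Fin n → MvPowerSeries (Fin n) κ → MvPowerSeries (Fin n) κ := fun i f => show MvPowerSeries (Fin n) κ from fun A : Fin n →₀ ℕ => ((A i + 1 : ℕ) : κ) * f (A + Finsupp.single i 1); let jac : ((Fin n → ℕ) → κ) → Ideal (MvPowerSeries (Fin n) κ) := fun c => Ideal.span (Set.range (fun i => pd i (ser c))); let Isol : ((Fin n → ℕ) → κ) → Prop := fun c => Module.Finite κ (MvPowerSeries (Fin n) κ ⧸ jac c); let MultP : ((Fin n → ℕ) → κ) → Prop := fun c => (∃ A, clean c A ≠ 0) ∧ ∀ A, clean c A ≠ 0 → p ≤ Finset.sum Finset.univ (fun j => A j); ¬ (∀ m, Isol (run c₀ i t m) ∧ MultP (run c₀ i t m))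

-- `IsolatedForcedTermination` holds: proved by `Summit.ResolutionOfSingularities.ResolutionOfSingularities.Theorems.WildCones.IsolatedForcedTermination_proof` (its module imports this route file, so no `_holds` link can be stated here).

/-- item stmt-ResolutionOfSingularities-18231 · crux · rank 2 · open · by planner
why it might fail: p = 2: the margin is ONE condition per step (net +1 generically at isolated order-2 states, refuter on 18129); a positive-dimensional stratum of isolated order-p states whose successor condition recurs automatically (a cheap eternal ISOLATED family) gives slope ≤ 0.
sources: arXiv:1802.05010, Moh1987, Hauser2008Kangaroo, arXiv:1412.0868, Giraud1975, arXiv:1005.4503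
[crux] THE CERTIFICATE, repaired (refuter's C′ after EscapeRateLinearCodimGrowth_refuted, class
misstated): ISOLATED persistence is exponentially rare. For every prime p and n ≥ 1 there are a b C
: ℕ, a, b > 0, such that for all N, M with p(N+2) ≤ M and all sufficiently large finite fields κ of
char p: every finite family F of starts c₀ : (Fin n → ℕ) → κ supported in degrees ≤ M, each
admitting a word (charts i, translations t in the algebraic closure of κ) along which ALL states
0..N of the point-blow-up dynamics (clean / blow up / divide by u_i^p / translate / clean, verbatim
from stmt-16343) are ISOLATED (`Isol`: finite colength of the Jacobian ideal of the cleaned series,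
verbatim from the target) and of multiplicity p (`MultP`: cleaned order ≥ p, non-zero), satisfies
|F|^b · q^(aN) ≤ q^(b(C + C(M+n,n))). Unrestricted persistence is NOT rare (refuted: cleaned order ≥
2p before a blow-up makes the exceptional hyperplane a p-fold locus that persists for free, codim ≤
17 at (p,n) = (2,2) — Theorems/LinearCodimGrowth/Negative/EternalFamily.lean); isolatedness confines
every non-final state of a counted run to cleaned order p or p+1 (n = 2), exactly p (n ≥ 3), since
order ≥ p+2 puts -/
@[route_item "route-ResolutionOfSingularities-EscapeRate", crux]
def LinearCodimGrowthIso : Prop :=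
  ∀ p : ℕ, p.Prime → ∀ n : ℕ, 0 < n → ∃ a b C : ℕ, 0 < a ∧ 0 < b ∧ ∀ N M : ℕ, p * (N + 2) ≤ M → ∃ r₀ : ℕ, ∀ (κ : Type) [Field κ] [Fintype κ] [CharP κ p], p ^ r₀ ≤ Fintype.card κ → let L := AlgebraicClosure κ; let clean : ((Fin n → ℕ) → L) → ((Fin n → ℕ) → L) := fun c A => @ite L (∀ j, p ∣ A j) (Classical.dec _) 0 (c A); let bl : Fin n → ((Fin n → ℕ) → L) → ((Fin n → ℕ) → L) := fun i c B => @ite L (Finset.sum (Finset.univ.erase i) (fun j => B j) ≤ B i) (Classical.dec _) (c (Function.update B i (B i - Finset.sum (Finset.univ.erase i) (fun j => B j)))) 0; let ord : ((Fin n → ℕ) → L) → ℕ := fun c => sInf {m : ℕ | ∃ A, c A ≠ 0 ∧ m = Finset.sum Finset.univ (fun j => A j)}; let dv : Fin n → ℕ → ((Fin n → ℕ) → L) → ((Fin n → ℕ) → L) := fun i s c B => c (Function.update B i (B i + s)); let tr : Fin n → (Fin n → L) → ℕ → ((Fin n → ℕ) → L) → ((Fin n → ℕ) → L) := fun i τ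 s c B => Finset.sum (Fintype.piFinset (fun _ : Fin n => Finset.range (B i + s + 1))) (fun D => @ite L (D i = 0) (Classical.dec _) (c (B + D) * Finset.prod (Finset.univ.erase i) (fun j => ((Nat.choose (B j + D j) (B j) : ℕ) : L) * τ j ^ (D j))) 0); let step : Fin n → (Fin n → L) → ((Fin n → ℕ) → L) → ((Fin n → ℕ) → L) := fun i τ c => clean (tr i τ (@ite ℕ (p ≤ ord (clean c)) (Classical.dec _) p 0) (dv i (@ite ℕ (p ≤ ord (clean c)) (Classical.dec _) p 0) (bl i (clean c)))); let run : ((Fin n → ℕ) → L) → (ℕ → Fin n) → (ℕ → Fin n → L) → ℕ → ((Fin n → ℕ) → L) := fun c₀ i t m => @Nat.rec (fun _ => (Fin n → ℕ) → L) c₀ (fun m c => step (i m) (t m) c) m; let ser : ((Fin n → ℕ) → L) → MvPowerSeries (Fin n) L := fun c => show MvPowerSeries (Fin n) L from fun A : Fin n →₀ ℕ => clean c ⇑A; let pd : Fin n → MvPowerSeries (Fin n) L → MvPowerSeries (Fin n) L := fun i f => show MvPowerSeries (Fin n) L from fun A : Fin n →₀ ℕ => ((A i + 1 : ℕ) : L)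 * f (A + Finsupp.single i 1); let jac : ((Fin n → ℕ) → L) → Ideal (MvPowerSeries (Fin n) L) := fun c => Ideal.span (Set.range (fun i => pd i (ser c))); let Isol : ((Fin n → ℕ) → L) → Prop := fun c => Module.Finite L (MvPowerSeries (Fin n) L ⧸ jac c); let MultP : ((Fin n → ℕ) → L) → Prop := fun c => (∃ A, clean c A ≠ 0) ∧ ∀ A, clean c A ≠ 0 → p ≤ Finset.sum Finset.univ (fun j => A j); let Persist : ((Fin n → ℕ) → κ) → Prop := fun c₀ => ∃ (i : ℕ → Fin n) (t : ℕ → Fin n → L), ∀ m, m ≤ N → Isol (run (fun A => algebraMap κ L (c₀ A)) i t m) ∧ MultP (run (fun A => algebraMap κ L (c₀ A)) i t m); let Supp : ((Fin n → ℕ) → κ) → Prop := fun c₀ => ∀ A : Fin n → ℕ, M < Finset.sum Finset.univ (fun j => A j) → c₀ A = 0; ∀ F : Finset ((Fin n → ℕ) → κ), (∀ c₀ ∈ F, Supp c₀ ∧ Persist c₀) → F.card ^ b * Fintype.card κ ^ (a * N) ≤ Fintype.card κ ^ (b * (C + Nat.choose (M + n) n))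

/-- item stmt-ResolutionOfSingularities-16345 · crux · rank 3 · open · by planner
why it might fail: the unforced regime may carry the whole difficulty (CossartPiltant2019 Rem 3.2: ω rises under a permissible centre in dim 4; Hauser–Perlega cycles are unforced): then forced termination buys nothing and Steer is LuAlphaPTorsor again.
sources: arXiv:1412.0868, arXiv:1802.05010, CutkoskyMourtada2019, NovacoskiSpivakovsky2014, Temkin2013, Literature.Barriers.ResolutionOfSingularities.DimensionFourFrontier
[crux] STEERING: if no perfect field carries an infinite chain of isolated multiplicity-p infinitely
near points of a height-one atom (IsolatedForcedTermination, the target), then α_p-torsors over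
bases regular at the centre are uniformizable along every valuation over every perfect field (the
body of TorsorLUPerfect, inlined). Content: at NON-isolated (unforced) stages a positive-dimensional
permissible centre through the centre of the valuation exists; choose it (maximal E-permissible
coordinate stratum, CossartPiltant2019-style) and show the run returns to the isolated regime or
drops multiplicity — the dictionary model/valuation ↔ coefficient dynamics is ShadowGame's
WinToTorsorLU (0-dimensional reduction NovacoskiSpivakovsky2014, Cohen coefficient fields over
perfect κ, toroidal endgame Kato1994/Niziol2006). [deps: ClosingReduction] [difficulty:
open-problem] -/
@[route_item "route-ResolutionOfSingularities-EscapeRate", crux]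
def Steer : Prop :=
  IsolatedForcedTermination → ∀ p : ℕ, p.Prime → ∀ (k K : Type) [Field k] [CharP k p] [PerfectField k] [Field K] [Algebra k K] (O : ValuationSubring K) (A₀ : Subalgebra k K) (h₀ : A₀.toSubring ≤ O.toSubring) (t : K), A₀.FG → t ^ p ∈ A₀ → IsFractionRing (Algebra.adjoin k (insert t (A₀ : Set K))) K → IsRegularLocalRing (Localization.AtPrime (Ideal.comap (Subring.inclusion h₀) (IsLocalRing.maximalIdeal O))) → ∃ (A : Subalgebra k K) (h : A.toSubring ≤ O.toSubring), A₀ ≤ A ∧ t ∈ A ∧ A.FG ∧ IsFractionRing A K ∧ IsRegularLocalRing (Localization.AtPrime (Ideal.comap (Subring.inclusion h) (IsLocalRing.maximalIdeal O)))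

/-- item stmt-ResolutionOfSingularities-18232 · crux · rank 4 · open · by planner
why it might fail: transport of the typed `step` (divide by u_i^p, clean, re-chart) along K[[u]]-automorphisms is unpublished; the ACF_p sentence must encode `run` plus a uniform Jacobian-colength bound as an L_ring formula (laborious, XL); BGM Cor 2.4 is a vendored unproved leaf.
sources: arXiv:1005.4503, arXiv:1708.02442, arXiv:1802.05010, Literature.AlgebraicGeometry.Resolution.BoubakriGreuelMarkwig.Cor24, Varshavsky2014, LangWeil1954
[crux] RARITY + DETERMINACY ⇒ TERMINATION OF THE ISOLATED CORE: LinearCodimGrowthIso →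
IsolatedForcedTermination (supersedes RarityToTermination, vacuous once its antecedent
LinearCodimGrowth was refuted). Plan: (i) an infinite all-isolated multiplicity-p run from a₀ over a
perfect κ gives, by RIGHT finite determinacy of the isolated cleaned series (BGM Cor 2.4, bound 2μ −
ord + 2: Literature.AlgebraicGeometry.Resolution.BoubakriGreuelMarkwig.Cor24, vendored) and
transport of runs along κ̄[[u]]-automorphisms (blow-up of the closed point, exceptional divisor and
division by its equation are intrinsic; every closed point of E is a chart point; Isol and MultP are
invariant), that every a ≡ a₀ mod m^(M′) over κ̄ has an N-step all-ISOLATED multiplicity-p word for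
every N — the cylinder lies in the isolated persistence locus, which is what the repaired
certificate counts; (ii) "some M′-jet whose whole degree-≤-M fibre persists N steps isolatedly" is a
first-order sentence over F_p (Isol on the fibre ⟸ Jacobian colength ≤ B with B uniform on the
cylinder by transport; colength ≤ B is first-order), true in κ̄, hence in F̄_p (Mathlib
FirstOrder.Field.ACF_isComplete), giving a cylinder of co -/
@[route_item "route-ResolutionOfSingularities-EscapeRate", crux]
def RarityToTerminationIso : Prop :=
  LinearCodimGrowthIso → IsolatedForcedTermination

/-- item stmt-ResolutionOfSingularities-16162 · crux · rank 5 · open · by planner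
why it might fail: rests on Temkin2013 Thm 1.3.2 (vendored fact with an unproved leaf Temkin2013RelativeCurveSmoothFibre) and on Temkin's model dominating the GIVEN R (relative form); smooth ≠ regular bookkeeping at each tower step.
sources: Temkin2013, arXiv:0804.1554, Literature.AlgebraicGeometry.Resolution.Temkin2013Relative, Literature.Barriers.ResolutionOfSingularities.InseparableBaseChange
[crux] Temkin's inseparable reduction over PERFECT ground fields: for every prime p, LU of
α_p-torsors over bases regular at the centre (TorsorLUPerfect at p) implies relative LU for every
f.g. K/k, k perfect of char p (Temkin2013 Thm 1.3.2: after a finite purely inseparable L/K an affine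
model is uniformized with smooth centre; Frobenius F^n moves it into K (k perfect, so k^{p^n} = k
and the transport is finite); the tower K₀ ⊂ … ⊂ K of degree-p radical steps is climbed by the
torsor crux). Valuative's TorsorToLurel (stmt-10968) is the all-k version. [difficulty: L] -/
@[route_item "route-ResolutionOfSingularities-EscapeRate", crux]
def TorsorToLurelPerfect : Prop :=
  ∀ p : ℕ, p.Prime → (∀ (k K : Type) [Field k] [CharP k p] [PerfectField k] [Field K] [Algebra k K] (O : ValuationSubring K) (A₀ : Subalgebra k K) (h₀ : A₀.toSubring ≤ O.toSubring) (t : K), A₀.FG → t ^ p ∈ A₀ → IsFractionRing (Algebra.adjoin k (insert t (A₀ : Set K))) K → IsRegularLocalRing (Localization.AtPrime (Ideal.comap (Subring.inclusion h₀) (IsLocalRing.maximalIdeal O))) → ∃ (A : Subalgebra k K) (h : A.toSubring ≤ O.toSubring), A₀ ≤ A ∧ t ∈ A ∧ A.FG ∧ IsFractionRing A K ∧ IsRegularLocalRing (Localization.AtPrime (Ideal.comap (Subring.inclusion h) (IsLocalRing.maximalIdeal O)))) → ∀ (k K : Type) [Field k] [CharP k p] [PerfectField k] [Field K] [Algebra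 k K], (⊤ : IntermediateField k K).FG → ∀ O : ValuationSubring K, (∀ c : k, algebraMap k K c ∈ O) → ∀ R : Subalgebra k K, R.FG → R.toSubring ≤ O.toSubring → ∃ (A : Subalgebra k K) (h : A.toSubring ≤ O.toSubring), R ≤ A ∧ A.FG ∧ IsFractionRing A K ∧ IsRegularLocalRing (Localization.AtPrime (Ideal.comap (Subring.inclusion h) (IsLocalRing.maximalIdeal O)))

/-- item stmt-ResolutionOfSingularities-16161 · crux · rank 6 · open · by planner
why it might fail: patching LUs into one proper regular model is known only in dim ≤ 3 (Zariski; CossartPiltant2008 Prop 4.9 / Piltant2013 need embedded resolution one dimension down); in dim ≥ 4 no reduction Res ⇐ LU exists even in char 0 (CutkoskyMourtada2019 p.3).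
sources: CutkoskyMourtada2019, Temkin2013, CossartPiltant2019, NovacoskiSpivakovsky2014, Literature.Barriers.ResolutionOfSingularities.DimensionFourFrontier
[crux] Zariski patching over PERFECT ground fields: for every prime p, relative local uniformization
(every f.g. R ⊆ O is dominated by a f.g. A ⊆ O with Frac A = K, regular at the centre) for all f.g.
K/k with k perfect of char p implies that every reduced separated scheme of finite type over every
perfect field of char p has a resolution. Fibrewise identical to Valuative's PatchingRel (stmt-0642)
restricted to perfect k — one patching argument proves both. [difficulty: open-problem] -/
@[route_item "route-ResolutionOfSingularities-EscapeRate", crux]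
def PatchingRelPerfect : Prop :=
  ∀ p : ℕ, p.Prime → (∀ (k K : Type) [Field k] [CharP k p] [PerfectField k] [Field K] [Algebra k K], (⊤ : IntermediateField k K).FG → ∀ O : ValuationSubring K, (∀ c : k, algebraMap k K c ∈ O) → ∀ R : Subalgebra k K, R.FG → R.toSubring ≤ O.toSubring → ∃ (A : Subalgebra k K) (h : A.toSubring ≤ O.toSubring), R ≤ A ∧ A.FG ∧ IsFractionRing A K ∧ IsRegularLocalRing (Localization.AtPrime (Ideal.comap (Subring.inclusion h) (IsLocalRing.maximalIdeal O)))) → ∀ (k : Type) [Field k] [CharP k p] [PerfectField k] (X : AlgebraicGeometry.Scheme.{0}) (f : X ⟶ AlgebraicGeometry.Spec (.of k)), AlgebraicGeometry.IsSeparated f → AlgebraicGeometry.LocallyOfFiniteType f → AlgebraicGeometry.QuasiCompact f → AlgebraicGeometry.IsReduced X → Literature.AlgebraicGeometry.Resolution.Scheme.HasResolution X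

/-- item stmt-ResolutionOfSingularities-0549 · crux · rank 7 · open · by planner
why it might fail: only known mechanism spreads X over a f.g. field of definition and base-changes a resolution over a perfect subfield back; regular is not geometrically regular under inseparable extension (EGA IV 6.7.4), e.g. k = F_p((t)) (Temkin2008 Question 3.3.3 open).
sources: arXiv:math/0703678, Kollar2007, Literature.Barriers.ResolutionOfSingularities.InseparableBaseChange, Literature.Barriers.ResolutionOfSingularities.RegularNotGeometricallyRegular
PerfectToAll: for a prime p, resolution of all reduced separated finite-type schemes over all
PERFECT fields of char p implies ResolutionInChar p (all fields of char p). Expected inputs: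
Neron-Popescu (Stacks 07GC), spreading out, openness of regular locus on excellent schemes;
regularity is not stable under inseparable ground field extension, which is the difficulty. -/
@[route_item "route-ResolutionOfSingularities-EscapeRate", crux]
def DescentPerfectToAll : Prop :=
  ∀ p : ℕ, p.Prime → (∀ (k : Type) [Field k] [CharP k p] [PerfectField k] (X : AlgebraicGeometry.Scheme.{0}) (f : X ⟶ AlgebraicGeometry.Spec (.of k)), AlgebraicGeometry.IsSeparated f → AlgebraicGeometry.LocallyOfFiniteType f → AlgebraicGeometry.QuasiCompact f → AlgebraicGeometry.IsReduced X → Literature.AlgebraicGeometry.Resolution.Scheme.HasResolution X) → Literature.AlgebraicGeometry.Resolution.ResolutionInChar.{0} p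

-- earlier Assembly (stmt-ResolutionOfSingularities-18130, replaced 2026-08-17T14:40:16Z -> stmt-ResolutionOfSingularities-18233): retired by None — LinearCodimGrowth → RarityToTermination → Steer → TorsorToLurelPerfect → PatchingRelPerfect → DescentPerfectToAll → _root_.ResolutionOfSingularities
/-- item stmt-ResolutionOfSingularities-18233 · assembly · rank 1 · open · by planner
sources: arXiv:1802.05010, Temkin2013
[assembly] LinearCodimGrowthIso → RarityToTerminationIso → Steer → TorsorToLurelPerfect →
PatchingRelPerfect → DescentPerfectToAll → the Statement (repaired chain; `closes` factors through
it). -/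
@[route_item "route-ResolutionOfSingularities-EscapeRate", crux]
def Assembly : Prop :=
  LinearCodimGrowthIso → RarityToTerminationIso → Steer → TorsorToLurelPerfect → PatchingRelPerfect → DescentPerfectToAll → _root_.ResolutionOfSingularities

-- records of items no longer active in this route (dropped / restated):
-- earlier LinearCodimGrowth (stmt-ResolutionOfSingularities-18128, replaced 2026-08-17T14:40:16Z -> stmt-ResolutionOfSingularities-18231): refuted by Summit.ResolutionOfSingularities.ResolutionOfSingularities.Theorems.EscapeRateLinearCodimGrowth_refuted @ fb13758004db — ∀ p : ℕ, p.Prime → ∀ n : ℕ, 0 < n → ∃ a b C : ℕ, 0 < a ∧ 0 < b ∧ ∀ N M : ℕ, p * (N + 2) ≤ M → ∃ r₀ : ℕ, ∀ (κ : Type) [Field κ] [Fin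
-- earlier RarityToTermination (stmt-ResolutionOfSingularities-18129, replaced 2026-08-17T14:40:16Z -> stmt-ResolutionOfSingularities-18232): retired by None — LinearCodimGrowth → IsolatedForcedTermination

/-! D-0027 §2.1 — DECIDING THEOREM (planner-authored via `route open/edit --closes-file`; by planner-rbadge-ResolutionOfSingularities-Escap-008b830f-g6-0 2026-08-17T18:06:33Z):
its hypotheses are this route's items and its conclusion the sub-problem Statement (glue_lint), and it elaborates with this file. -/

@[closes "route-ResolutionOfSingularities-EscapeRate"] theorem closes (hA : Assembly) (hL : LinearCodimGrowthIso) (hR : RarityToTerminationIso) (hS : Steer)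
    (hT : TorsorToLurelPerfect) (hP : PatchingRelPerfect) (hD : DescentPerfectToAll) :
    _root_.ResolutionOfSingularities :=
  hA hL hR hS hT hP hD

end Summit.ResolutionOfSingularities.ResolutionOfSingularities.Theses.EscapeRate
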